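import Summits.NavierStokesRegularity.NavierStokesRegularity.Theorems.PerpetualPumpAveragedTypeIBlowupPreviousPairDecay

/-!
# Crux `PerpetualPump.AveragedTypeIBlowup` (stmt-NavierStokesRegularity-1835), line `Sketch`:
# stub `previousPair` — a priori estimates inside the bootstrap tube, III (the dump)

Continuation of `…PreviousPairDecay` (same section variables = standing hypotheses of the stub
`previousPair` + the bootstrap tube on `[0, s]`). Energy ("dump") bounds for the transfer
`κ ∫ wp²`, from the energy identity `2κ ∫ R wp² = wp(t₀)² - wp(t)² + 2∫ wp F`
(`previousPair_energy`) with the error `|∫ wp F| ≤ 3/200`: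

* `prevPair_Q_dump` — during the dump `t ≤ σd := 30/B` (rate `R ≥ (B-33)/q`):
  `(B - 33) κ∫₀^t wp² ≤ q⁴(B+2)/2`;
* `prevPair_V_σd` — `wp(σd)² ≤ B/30000` (decay `e^{-22} ≤ 1/39000`);
* `prevPair_Q_mid`, `prevPair_Q_after`, `prevPair_Q_tail` — the tail
  `κ ∫_{σd}^t wp² ≤ 1/125`;
* `prevPair_Q_sharp` — `κ ∫₀^t wp² ≤ 16/25` on `[0, s]` (registered sub-goal
  `stub_prevPairDump`; closes the tube condition `κ∫wp² ≤ 1` and gives conclusion (C)).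

## References

T. Tao, *Finite time blowup for an averaged three-dimensional Navier–Stokes equation*, J. Amer.
Math. Soc. 29 (2016), §5–6; folklore ODE calculus.
-/

noncomputable section

-- the summit namespace `…NavierStokesRegularity.NavierStokesRegularity…` is the tree convention
set_option linter.dupNamespace false
-- every lemma of this file lives inside one `variable … include` context (the bootstrap tube);
-- not every lemma uses every bundled hypothesis
set_option linter.unusedSectionVars false

open MeasureTheory Set Filter Topology

namespace Summit.NavierStokesRegularity.NavierStokesRegularity.Theorems.PerpetualPumpAveragedTypeIBlowup

section Tube

variable {bp wp b m0 m1 wl e0 e1 : ℝ → ℝ} {B Λ κ q θ η εb ω μ σI T s : ℝ}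

variable (hκq : 4 / 5 ≤ κ ∧ κ ≤ 1 ∧ 1 ≤ q ∧ q ≤ 21 / 20)
  (hsm : 0 ≤ η ∧ 0 < εb ∧ 10 * εb ≤ ω ∧ ω ≤ 1 / 100 ∧ 0 ≤ μ ∧
    η * (μ + 2 * Real.sqrt B) ≤ ω / 10 ∧ η * μ ≤ 1 / 20 ∧ 1 / 2 ≤ θ ∧ θ ≤ 1)
  (hBT : 1000 ≤ B ∧ 0 < σI ∧ σI ≤ 3 ∧ 0 < T ∧ T ≤ 10)
  (hΛ : 100 ≤ Λ ∧ Λ ≤ B * (1 - Real.exp (-σI)) ∧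
    11 * Real.sqrt B * Real.exp (-(κ * Λ / 3)) ≤ ω)
  (hcont : ContinuousOn bp (Icc 0 T) ∧ ContinuousOn wp (Icc 0 T) ∧ ContinuousOn b (Icc 0 T) ∧
    ContinuousOn m0 (Icc 0 T) ∧ ContinuousOn m1 (Icc 0 T) ∧ ContinuousOn wl (Icc 0 T) ∧
    ContinuousOn e0 (Icc 0 T) ∧ ContinuousOn e1 (Icc 0 T))
  (hode : (∀ σ ∈ Ioo 0 T, HasDerivAt bp
      (κ * (-(bp σ) - (wp σ) ^ 2 + (wl σ) ^ 2 - εb * bp σ * wp σ) + e0 σ) σ) ∧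
    (∀ σ ∈ Ioo 0 T, HasDerivAt wp
      (κ * (wp σ * (bp σ - b σ / q - 1) + εb * (bp σ) ^ 2) + e1 σ) σ))
  (herr : (∀ σ ∈ Icc 0 T, |e0 σ| ≤ η * κ * m0 σ) ∧ (∀ σ ∈ Icc 0 T, |e1 σ| ≤ η * κ * m1 σ) ∧
    (∀ σ ∈ Icc 0 T, 0 ≤ m0 σ ∧ m0 σ ≤ m0 0 * Real.exp (-(θ * κ * σ)) +
      κ * ∫ u in (0 : ℝ)..σ, Real.exp (-(θ * κ * (σ - u))) *
        |-(wp u) ^ 2 + (wl u) ^ 2 - εb * bp u * wp u|) ∧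
    (∀ σ ∈ Icc 0 T, 0 ≤ m1 σ ∧ m1 σ ≤ m1 0 * Real.exp (-(θ * κ * σ)) +
      κ * ∫ u in (0 : ℝ)..σ, Real.exp (-(θ * κ * (σ - u))) *
        |wp u * (bp u - b u / q) + εb * (bp u) ^ 2|))
  (henv : (∀ σ ∈ Icc 0 T, |wl σ| ≤ ω) ∧
    (∀ σ ∈ Icc 0 (min T σI), B * Real.exp (-σ) - 3 ≤ b σ) ∧
    (∀ σ ∈ Icc 0 T, -(1 / 2) ≤ b σ ∧ b σ ≤ B + 3))
  (hini : q ^ 4 / 2 - 3 / 20 ≤ bp 0 ∧ bp 0 ≤ q ^ 4 / 2 + 1 / 10 ∧ 0 ≤ wp 0 ∧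
    q ^ 3 * B - 1 ≤ (wp 0) ^ 2 ∧ (wp 0) ^ 2 ≤ q ^ 3 * B + 1 ∧ m0 0 ≤ μ ∧ m1 0 ≤ μ)
  (hs : s ∈ Icc 0 T)
  (hT : ∀ σ ∈ Icc 0 s, -(1 / 2) ≤ bp σ ∧ bp σ ≤ 9 / 10 ∧ (σ ≤ σI ∨ bp σ ≤ 2 / 5) ∧
    m1 σ ≤ μ + 3 * Real.sqrt B ∧ κ * ∫ u in (0 : ℝ)..σ, (wp u) ^ 2 ≤ 1)

include hκq hsm hBT hΛ hcont hode herr henv hini hs hT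

/-- Shorthand context: continuity, the damped bond equation, rates and forcing on `[0, s]`.
[folklore] -/
theorem prevPair_ctx :
    (ContinuousOn (fun σ => b σ / q + 1 - bp σ) (Icc 0 s) ∧
      ContinuousOn (fun σ => κ * εb * bp σ ^ 2 + e1 σ) (Icc 0 s) ∧
      ContinuousOn wp (Icc 0 s) ∧ ContinuousOn bp (Icc 0 s)) ∧
    (∀ σ ∈ Ioo 0 s, HasDerivAt wp
      (-(κ * (b σ / q + 1 - bp σ) * wp σ) + (κ * εb * bp σ ^ 2 + e1 σ)) σ) ∧
    (∀ σ ∈ Icc 0 s, 1 / 10 ≤ b σ / q + 1 - bp σ ∧ b σ / q + 1 - bp σ ≤ B + 9 / 2 ∧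
      (σ ≤ σI → B / 25 + 1 / 10 ≤ b σ / q + 1 - bp σ) ∧
      (σ ≤ 30 / B → (B - 33) / q + 1 / 10 ≤ b σ / q + 1 - bp σ)) ∧
    (∀ σ ∈ Icc 0 s, |κ * εb * bp σ ^ 2 + e1 σ| ≤ κ * ω / 4) :=
  ⟨prevPair_cont hκq hsm hBT hΛ hcont hode herr henv hini hs hT,
    fun _ hσ => prevPair_wp_ode hκq hsm hBT hΛ hcont hode herr henv hini hs hT hσ,
    fun _ hσ => prevPair_rate hκq hsm hBT hΛ hcont hode herr henv hini hs hT hσ,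
    fun _ hσ => prevPair_F_le hκq hsm hBT hΛ hcont hode herr henv hini hs hT hσ⟩

/-- **Energy error.** For `0 ≤ t₀ ≤ t ≤ s`: `|∫_{t₀}^t wp F| ≤ 3/200`
(`|wp F| ≤ (κω/4)|wp| ≤ (κω/8)(1 + wp²)` and `κ ∫ wp² ≤ 1`). [folklore] -/
theorem prevPair_xF {t₀ t : ℝ} (h0 : 0 ≤ t₀) (h0t : t₀ ≤ t) (hts : t ≤ s) :
    |∫ u in t₀..t, wp u * (κ * εb * bp u ^ 2 + e1 u)| ≤ 3 / 200 := by
  obtain ⟨⟨-, hFc, hwpc, -⟩, -, -, hFle⟩ :=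
    prevPair_ctx hκq hsm hBT hΛ hcont hode herr henv hini hs hT
  obtain ⟨hκ0, hκ1, -, -⟩ := hκq
  obtain ⟨-, hεb, hεω, hω, -, -, -, -, -⟩ := hsm
  obtain ⟨-, -, -, -, hT10⟩ := hBT
  have hκ : 0 < κ := by linarith
  have hω0 : 0 ≤ ω := by linarith
  have htS : t ∈ Icc 0 s := ⟨h0.trans h0t, hts⟩
  have hsub : Icc t₀ t ⊆ Icc 0 s := fun u hu => ⟨h0.trans hu.1, hu.2.trans hts⟩
  have hpt : ∀ u ∈ Icc t₀ t, |wp u * (κ * εb * bp u ^ 2 + e1 u)| ≤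
      κ * ω / 8 * (1 + wp u ^ 2) := by
    intro u hu
    rw [abs_mul]
    have h1 := hFle u (hsub hu)
    have h2 : |wp u| ≤ (1 + wp u ^ 2) / 2 := by
      nlinarith only [sq_nonneg (|wp u| - 1), sq_abs (wp u)]
    have h3 : |wp u| * |κ * εb * bp u ^ 2 + e1 u| ≤ (1 + wp u ^ 2) / 2 * (κ * ω / 4) :=
      mul_le_mul h2 h1 (abs_nonneg _) (by positivity)
    linarith only [h3]
  have hI1 : IntervalIntegrable (fun u => |wp u * (κ * εb * bp u ^ 2 + e1 u)|) volume t₀ t :=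
    ((hwpc.mul hFc).mono hsub).abs.intervalIntegrable_of_Icc h0t
  have hI3 : IntervalIntegrable (fun u => wp u ^ 2) volume t₀ t :=
    ((hwpc.mono hsub).pow 2).intervalIntegrable_of_Icc h0t
  have hI2 : IntervalIntegrable (fun u => κ * ω / 8 * (1 + wp u ^ 2)) volume t₀ t :=
    (intervalIntegrable_const.add hI3).const_mul _
  have hmono := intervalIntegral.integral_mono_on h0t hI1 hI2 hpt
  have habs := intervalIntegral.abs_integral_le_integral_abs
    (f := fun u => wp u * (κ * εb * bp u ^ 2 + e1 u)) (μ := volume) h0t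
  rw [intervalIntegral.integral_const_mul, intervalIntegral.integral_add intervalIntegrable_const
    hI3, intervalIntegral.integral_const, smul_eq_mul, mul_one] at hmono
  have hQt := (hT t htS).2.2.2.2
  have hwI : IntervalIntegrable (fun u => wp u ^ 2) volume 0 t :=
    ((hwpc.mono (Icc_subset_Icc_right hts)).pow 2).intervalIntegrable_of_Icc (h0.trans h0t)
  have hwI0 : IntervalIntegrable (fun u => wp u ^ 2) volume 0 t₀ :=
    ((hwpc.mono (Icc_subset_Icc_right (h0t.trans hts))).pow 2).intervalIntegrable_of_Icc h0
  have hsplit : ∫ u in t₀..t, wp u ^ 2 =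
      (∫ u in (0:ℝ)..t, wp u ^ 2) - ∫ u in (0:ℝ)..t₀, wp u ^ 2 :=
    (intervalIntegral.integral_interval_sub_left hwI hwI0).symm
  have hnn : 0 ≤ ∫ u in (0:ℝ)..t₀, wp u ^ 2 :=
    intervalIntegral.integral_nonneg h0 fun u _ => sq_nonneg _
  generalize (∫ u in t₀..t, wp u ^ 2) = J at hmono hsplit
  generalize (∫ u in (0:ℝ)..t, wp u ^ 2) = Qt at hQt hsplit
  generalize (∫ u in (0:ℝ)..t₀, wp u ^ 2) = Q0 at hnn hsplit
  generalize (∫ u in t₀..t, |wp u * (κ * εb * bp u ^ 2 + e1 u)|) = A at hmono habs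
  generalize (∫ u in t₀..t, wp u * (κ * εb * bp u ^ 2 + e1 u)) = I at habs ⊢
  have ht10 : t - t₀ ≤ 10 := by linarith only [hts, hs.2, hT10, h0]
  have hκJ : κ * J ≤ 1 := by rw [hsplit]; nlinarith only [hQt, hnn, hκ]
  have hκt : κ * (t - t₀) ≤ 10 := by nlinarith only [hκ1, ht10, hκ, h0t]
  have h5 : κ * ω / 8 * ((t - t₀) + J) ≤ 11 / 800 := by
    nlinarith only [mul_le_mul_of_nonneg_right hκt hω0, mul_le_mul_of_nonneg_right hκJ hω0, hω]
  linarith only [habs, hmono, h5]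

/-- **The dump.** For `t ≤ 30/B`: `(B - 33) · κ∫₀^t wp² ≤ q⁴(B+2)/2` (energy identity with
`R ≥ (B-33)/q + 1/10` on `[0, t]`, `wp(0)² ≤ q³B + 1`). [folklore] -/
theorem prevPair_Q_dump {t : ℝ} (ht : t ∈ Icc 0 s) (htd : t ≤ 30 / B) :
    (B - 33) * (κ * ∫ u in (0:ℝ)..t, wp u ^ 2) ≤ q ^ 4 * (B + 2) / 2 := by
  obtain ⟨⟨hRc, hFc, hwpc, -⟩, hoder, hrate, -⟩ :=
    prevPair_ctx hκq hsm hBT hΛ hcont hode herr henv hini hs hT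
  have hxF := prevPair_xF hκq hsm hBT hΛ hcont hode herr henv hini hs hT le_rfl ht.1 ht.2
  obtain ⟨hκ0, -, hq1, -⟩ := hκq
  obtain ⟨-, -, -, -, hwp0sq, -, -⟩ := hini
  have hκ : 0 < κ := by linarith
  have hq0 : 0 < q := by linarith
  have hen := previousPair_energy (x := wp) (R := fun u => b u / q + 1 - bp u)
    (F := fun u => κ * εb * bp u ^ 2 + e1 u) (t₀ := 0) (t₁ := s) hwpc hRc hFc hoder ht
  have hsub : Icc 0 t ⊆ Icc 0 s := Icc_subset_Icc_right ht.2
  have hI : IntervalIntegrable (fun u => wp u ^ 2) volume 0 t :=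
    ((hwpc.mono hsub).pow 2).intervalIntegrable_of_Icc ht.1
  have hmono : ∫ u in (0:ℝ)..t, (B - 33) / q * wp u ^ 2 ≤
      ∫ u in (0:ℝ)..t, (b u / q + 1 - bp u) * wp u ^ 2 :=
    intervalIntegral.integral_mono_on ht.1 (hI.const_mul _)
      (((hRc.mul (hwpc.pow 2)).mono hsub).intervalIntegrable_of_Icc ht.1) fun u hu => by
        have hR := (hrate u (hsub hu)).2.2.2 (hu.2.trans htd)
        exact mul_le_mul_of_nonneg_right (by linarith only [hR]) (sq_nonneg _)
  rw [intervalIntegral.integral_const_mul] at hmono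
  generalize (∫ u in (0:ℝ)..t, wp u ^ 2) = I at hmono ⊢
  generalize (∫ u in (0:ℝ)..t, (b u / q + 1 - bp u) * wp u ^ 2) = IR at hmono hen
  generalize (∫ u in (0:ℝ)..t, wp u * (κ * εb * bp u ^ 2 + e1 u)) = X at hxF hen
  have h1 : (B - 33) * I ≤ q * IR := by
    have e : q * ((B - 33) / q * I) = (B - 33) * I := by field_simp
    nlinarith only [mul_le_mul_of_nonneg_left hmono hq0.le, e]
  have h2 : 2 * κ * IR ≤ q ^ 3 * B + 1 + 3 / 100 := by
    rw [hen]; linarith only [hwp0sq, sq_nonneg (wp t), (abs_le.1 hxF).2]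
  have h3 := mul_le_mul_of_nonneg_left h1 hκ.le
  have h4 := mul_le_mul_of_nonneg_left h2 (by positivity : (0:ℝ) ≤ q / 2)
  have hq4 : q ≤ q ^ 4 := le_self_pow₀ hq1 (by norm_num)
  nlinarith only [h3, h4, hq4, hq0]

/-- **End of the dump.** At `σd = 30/B`: `wp(σd)² ≤ B/30000`
(decay `e^{-κ σd ((B-33)/q + 1/10)} ≤ e^{-22} ≤ 1/39000` of `wp(0)² ≤ 1.16 B`). [folklore] -/
theorem prevPair_V_σd (hsd : 30 / B ≤ s) : wp (30 / B) ^ 2 ≤ B / 30000 := by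
  obtain ⟨hσB, -, -⟩ := prevPair_consts hκq hsm hBT hΛ hcont hode herr henv hini hs hT
  obtain ⟨⟨hRc, -, -, -⟩, -, hrate, -⟩ :=
    prevPair_ctx hκq hsm hBT hΛ hcont hode herr henv hini hs hT
  have hB0 : 0 < B := by linarith only [hBT.1]
  have hd0 : (0:ℝ) ≤ 30 / B := by positivity
  have hfr := (prevPair_wp_front hκq hsm hBT hΛ hcont hode herr henv hini hs hT
    ⟨hd0, hsd⟩ hσB).1
  obtain ⟨hκ0, -, hq1, hq2⟩ := hκq
  obtain ⟨-, hεb, hεω, hω, -, -, -, -, -⟩ := hsm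
  obtain ⟨hB, -, -, -, -⟩ := hBT
  obtain ⟨-, -, -, -, hwp0sq, -, -⟩ := hini
  have hq0 : 0 < q := by linarith
  have hmono : ∫ _ in (0:ℝ)..(30 / B), ((B - 33) / q + 1 / 10) ≤
      ∫ u in (0:ℝ)..(30 / B), (b u / q + 1 - bp u) :=
    intervalIntegral.integral_mono_on hd0 intervalIntegrable_const
      ((hRc.mono (Icc_subset_Icc_right hsd)).intervalIntegrable_of_Icc hd0)
      fun u hu => (hrate u ⟨hu.1, hu.2.trans hsd⟩).2.2.2 hu.2
  rw [intervalIntegral.integral_const, smul_eq_mul, sub_zero] at hmono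
  have hkey : 22 ≤ κ * (30 / B * ((B - 33) / q + 1 / 10)) := by
    have h1 : (B - 33) * (20 / 21) ≤ (B - 33) / q := by
      rw [le_div_iff₀ hq0]; nlinarith only [hq2, hB]
    have h2 : 30 / B * (B - 33) = 30 - 990 / B := by field_simp; ring
    have h3 : 990 / B ≤ 1 := by rw [div_le_iff₀ hB0]; linarith only [hB]
    have h4 : 30 / B * ((B - 33) * (20 / 21)) ≤ 30 / B * ((B - 33) / q + 1 / 10) :=
      mul_le_mul_of_nonneg_left (by linarith only [h1]) hd0
    have h5 : 30 / B * ((B - 33) * (20 / 21)) = (30 - 990 / B) * (20 / 21) := by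
      rw [← mul_assoc, h2]
    have h6 : (0:ℝ) ≤ 30 / B * ((B - 33) / q + 1 / 10) := by linarith only [h4, h5, h3]
    nlinarith only [h4, h5, h3, hκ0, h6]
  generalize (∫ u in (0:ℝ)..(30 / B), (b u / q + 1 - bp u)) = IR at hmono hfr
  have hE : Real.exp (-(κ * IR)) ≤ 1 / 39000 :=
    previousPair_exp_neg_le (by nlinarith only [hmono, hkey, hκ0])
  have hq3 : q ^ 3 ≤ 1158 / 1000 := by nlinarith [pow_le_pow_left₀ (by linarith) hq2 3]
  have hwp0 : wp 0 ^ 2 ≤ 29 / 25 * B := by nlinarith only [hwp0sq, hq3, hB]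
  have hhom : Real.exp (-(κ * IR)) * wp 0 ^ 2 ≤ 1 / 39000 * (29 / 25 * B) :=
    mul_le_mul hE hwp0 (sq_nonneg _) (by norm_num)
  have hω0 : 0 ≤ ω := by linarith only [hεb, hεω]
  have hc : 25 * ω / (4 * B) ≤ 1 / 10000 := by
    rw [div_le_div_iff₀ (by positivity) (by norm_num)]; nlinarith only [hω, hB]
  have hc2 : (25 * ω / (4 * B)) ^ 2 ≤ (1 / 10000) ^ 2 := pow_le_pow_left₀ (by positivity) hc 2
  nlinarith only [hfr, hhom, hc2, hB]

/-- **After the dump, before `σI`.** For `30/B ≤ t ≤ σI`: `κ ∫_{30/B}^t wp² ≤ 1/1000`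
(energy identity with `R ≥ B/25`, started from `wp(σd)² ≤ B/30000`). [folklore] -/
theorem prevPair_Q_mid {t : ℝ} (ht : t ∈ Icc (30 / B) s) (htI : t ≤ σI) :
    κ * ∫ u in (30 / B)..t, wp u ^ 2 ≤ 1 / 1000 := by
  obtain ⟨⟨hRc, hFc, hwpc, -⟩, hoder, hrate, -⟩ :=
    prevPair_ctx hκq hsm hBT hΛ hcont hode herr henv hini hs hT
  have hB0 : 0 < B := by linarith only [hBT.1]
  have hd0 : (0:ℝ) ≤ 30 / B := by positivity
  have hsd : 30 / B ≤ s := ht.1.trans ht.2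
  have hV := prevPair_V_σd hκq hsm hBT hΛ hcont hode herr henv hini hs hT hsd
  have hxF := prevPair_xF hκq hsm hBT hΛ hcont hode herr henv hini hs hT hd0 ht.1 ht.2
  obtain ⟨hκ0, -, -, -⟩ := hκq
  obtain ⟨hB, -, -, -, -⟩ := hBT
  have hκ : 0 < κ := by linarith
  have hsub : Icc (30 / B) s ⊆ Icc 0 s := Icc_subset_Icc_left hd0
  have hen := previousPair_energy (x := wp) (R := fun u => b u / q + 1 - bp u)
    (F := fun u => κ * εb * bp u ^ 2 + e1 u) (t₀ := 30 / B) (t₁ := s) (hwpc.mono hsub)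
    (hRc.mono hsub) (hFc.mono hsub) (fun u hu => hoder u ⟨hd0.trans_lt hu.1, hu.2⟩) ht
  have hsub' : Icc (30 / B) t ⊆ Icc 0 s := fun u hu => ⟨hd0.trans hu.1, hu.2.trans ht.2⟩
  have hI : IntervalIntegrable (fun u => wp u ^ 2) volume (30 / B) t :=
    ((hwpc.mono hsub').pow 2).intervalIntegrable_of_Icc ht.1
  have hmono : ∫ u in (30 / B)..t, B / 25 * wp u ^ 2 ≤
      ∫ u in (30 / B)..t, (b u / q + 1 - bp u) * wp u ^ 2 :=
    intervalIntegral.integral_mono_on ht.1 (hI.const_mul _)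
      (((hRc.mul (hwpc.pow 2)).mono hsub').intervalIntegrable_of_Icc ht.1) fun u hu => by
        have hR := (hrate u (hsub' hu)).2.2.1 (hu.2.trans htI)
        exact mul_le_mul_of_nonneg_right (by linarith only [hR]) (sq_nonneg _)
  rw [intervalIntegral.integral_const_mul] at hmono
  generalize (∫ u in (30 / B)..t, wp u ^ 2) = I at hmono ⊢
  generalize (∫ u in (30 / B)..t, (b u / q + 1 - bp u) * wp u ^ 2) = IR at hmono hen
  generalize (∫ u in (30 / B)..t, wp u * (κ * εb * bp u ^ 2 + e1 u)) = X at hxF hen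
  have h2 : 2 * κ * IR ≤ B / 30000 + 3 / 100 := by
    rw [hen]; linarith only [hV, sq_nonneg (wp t), (abs_le.1 hxF).2]
  -- `2κ (B/25) I ≤ B/30000 + 3/100`
  have h3 : 2 * κ * (B / 25 * I) ≤ B / 30000 + 3 / 100 := by
    nlinarith only [mul_le_mul_of_nonneg_left hmono (by positivity : (0:ℝ) ≤ 2 * κ), h2]
  have h4 : B * (κ * I) ≤ 25 / 2 * (B / 30000 + 3 / 100) := by nlinarith only [h3]
  have h5 : 25 / 2 * (B / 30000 + 3 / 100) ≤ B * (1 / 1000) := by nlinarith only [hB]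
  exact le_of_mul_le_mul_left (h4.trans h5) hB0

/-- **After `σI`.** For `σI ≤ t ≤ s`: `κ ∫_{σI}^t wp² ≤ 7/1000` (`wp² ≤ 7ω²` there). [folklore] -/
theorem prevPair_Q_after {t : ℝ} (ht : t ∈ Icc σI s) :
    κ * ∫ u in σI..t, wp u ^ 2 ≤ 7 / 1000 := by
  obtain ⟨⟨-, -, hwpc, -⟩, -, -, -⟩ :=
    prevPair_ctx hκq hsm hBT hΛ hcont hode herr henv hini hs hT
  have hweak := fun (u : ℝ) (hu : u ∈ Icc σI s) =>
    prevPair_wp_weak hκq hsm hBT hΛ hcont hode herr henv hini hs hT hu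
  obtain ⟨hκ0, hκ1, -, -⟩ := hκq
  obtain ⟨-, hεb, hεω, hω, -, -, -, -, -⟩ := hsm
  obtain ⟨-, hσI0, -, -, hT10⟩ := hBT
  have hsub : Icc σI t ⊆ Icc 0 s := fun u hu => ⟨hσI0.le.trans hu.1, hu.2.trans ht.2⟩
  have hmono : ∫ u in σI..t, wp u ^ 2 ≤ ∫ _ in σI..t, 7 * ω ^ 2 :=
    intervalIntegral.integral_mono_on ht.1
      (((hwpc.mono hsub).pow 2).intervalIntegrable_of_Icc ht.1) intervalIntegrable_const
      fun u hu => hweak u ⟨hu.1, hu.2.trans ht.2⟩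
  have hnn : 0 ≤ ∫ u in σI..t, wp u ^ 2 :=
    intervalIntegral.integral_nonneg ht.1 fun u _ => sq_nonneg _
  rw [intervalIntegral.integral_const, smul_eq_mul] at hmono
  generalize (∫ u in σI..t, wp u ^ 2) = I at hmono hnn ⊢
  have ht10 : t - σI ≤ 10 := by linarith only [ht.2, hs.2, hT10, hσI0]
  have hω2 : ω ^ 2 ≤ 1 / 10000 := by nlinarith only [hω, hεb, hεω]
  have h1 : I ≤ 7 / 1000 := by nlinarith only [hmono, ht10, hω2, sq_nonneg ω]
  nlinarith only [h1, hκ1, hκ0, hnn]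

/-- **The tail of the transfer.** For `30/B ≤ t ≤ s`: `κ ∫_{30/B}^t wp² ≤ 1/125`. [folklore] -/
theorem prevPair_Q_tail {t : ℝ} (ht : t ∈ Icc (30 / B) s) :
    κ * ∫ u in (30 / B)..t, wp u ^ 2 ≤ 1 / 125 := by
  obtain ⟨⟨-, -, hwpc, -⟩, -, -, -⟩ :=
    prevPair_ctx hκq hsm hBT hΛ hcont hode herr henv hini hs hT
  obtain ⟨hσB, -, -⟩ := prevPair_consts hκq hsm hBT hΛ hcont hode herr henv hini hs hT
  have hB0 : 0 < B := by linarith only [hBT.1]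
  have hd0 : (0:ℝ) ≤ 30 / B := by positivity
  rcases le_or_gt t σI with htI | htI
  · have := prevPair_Q_mid hκq hsm hBT hΛ hcont hode herr henv hini hs hT ht htI
    linarith only [this]
  · have hσIs : σI ≤ s := htI.le.trans ht.2
    have h1 := prevPair_Q_mid hκq hsm hBT hΛ hcont hode herr henv hini hs hT ⟨hσB, hσIs⟩ le_rfl
    have h2 := prevPair_Q_after hκq hsm hBT hΛ hcont hode herr henv hini hs hT ⟨htI.le, ht.2⟩
    have hI1 : IntervalIntegrable (fun u => wp u ^ 2) volume (30 / B) σI :=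
      ((hwpc.mono fun u hu => ⟨hd0.trans hu.1, hu.2.trans hσIs⟩).pow 2).intervalIntegrable_of_Icc
        hσB
    have hI2 : IntervalIntegrable (fun u => wp u ^ 2) volume σI t :=
      ((hwpc.mono fun u hu => ⟨(hd0.trans hσB).trans hu.1, hu.2.trans ht.2⟩).pow
        2).intervalIntegrable_of_Icc htI.le
    rw [← intervalIntegral.integral_add_adjacent_intervals hI1 hI2, mul_add]
    linarith only [h1, h2]

/-- **Sharp transfer bound.** `κ ∫₀^t wp² ≤ 16/25` on `[0, s]` (so the tube condition
`κ ∫ wp² ≤ 1` is never saturated, and conclusion (C) `≤ 9/10` holds): the dump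
`q⁴(B+2)/(2(B-33)) ≤ 0.632` plus the tail `1/125`. [folklore] -/
theorem prevPair_Q_sharp {t : ℝ} (ht : t ∈ Icc 0 s) :
    κ * ∫ u in (0:ℝ)..t, wp u ^ 2 ≤ 16 / 25 := by
  obtain ⟨⟨-, -, hwpc, -⟩, -, -, -⟩ :=
    prevPair_ctx hκq hsm hBT hΛ hcont hode herr henv hini hs hT
  have hB : 1000 ≤ B := hBT.1
  have hB0 : 0 < B := by linarith only [hB]
  have hd0 : (0:ℝ) ≤ 30 / B := by positivity
  have hq4 : q ^ 4 ≤ 194481 / 160000 := by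
    have := pow_le_pow_left₀ (by linarith only [hκq.2.2.1]) hκq.2.2.2 4
    norm_num at this
    exact this
  -- the dump bound, for any `t' ≤ 30/B`
  have hdump : ∀ t' ∈ Icc 0 s, t' ≤ 30 / B → κ * ∫ u in (0:ℝ)..t', wp u ^ 2 ≤ 79 / 125 := by
    intro t' ht' htd
    have h := prevPair_Q_dump hκq hsm hBT hΛ hcont hode herr henv hini hs hT ht' htd
    generalize κ * ∫ u in (0:ℝ)..t', wp u ^ 2 = Q at h ⊢
    have key : (B - 33) * Q ≤ (B - 33) * (79 / 125) := by
      nlinarith only [h, mul_le_mul_of_nonneg_right hq4 (by linarith only [hB] : (0:ℝ) ≤ B + 2),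
        hB]
    exact le_of_mul_le_mul_left key (by linarith only [hB])
  rcases le_or_gt t (30 / B) with htd | htd
  · exact (hdump t ht htd).trans (by norm_num)
  · have h1 := hdump (30 / B) ⟨hd0, htd.le.trans ht.2⟩ le_rfl
    have h2 := prevPair_Q_tail hκq hsm hBT hΛ hcont hode herr henv hini hs hT ⟨htd.le, ht.2⟩
    have hI1 : IntervalIntegrable (fun u => wp u ^ 2) volume 0 (30 / B) :=
      ((hwpc.mono (Icc_subset_Icc_right (htd.le.trans ht.2))).pow 2).intervalIntegrable_of_Icc
        hd0
    have hI2 : IntervalIntegrable (fun u => wp u ^ 2) volume (30 / B) t :=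
      ((hwpc.mono fun u hu => ⟨hd0.trans hu.1, hu.2.trans ht.2⟩).pow 2).intervalIntegrable_of_Icc
        htd.le
    rw [← intervalIntegral.integral_add_adjacent_intervals hI1 hI2, mul_add]
    linarith only [h1, h2]

end Tube

/-- **Registered sub-goal `stub_prevPairDump`** (stub `previousPair`, line `Sketch`):
inside the bootstrap tube on `[0, s]`, the transfer obeys the SHARP bound `κ ∫₀^t wp² ≤ 16/25`.
[folklore] -/
theorem stub_prevPairDump :
    ∀ (bp wp b m0 m1 wl e0 e1 : ℝ → ℝ) (B Λ κ q θ η εb ω μ σI T s : ℝ),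
      (4 / 5 ≤ κ ∧ κ ≤ 1 ∧ 1 ≤ q ∧ q ≤ 21 / 20) →
      (0 ≤ η ∧ 0 < εb ∧ 10 * εb ≤ ω ∧ ω ≤ 1 / 100 ∧ 0 ≤ μ ∧
        η * (μ + 2 * Real.sqrt B) ≤ ω / 10 ∧ η * μ ≤ 1 / 20 ∧ 1 / 2 ≤ θ ∧ θ ≤ 1) →
      (1000 ≤ B ∧ 0 < σI ∧ σI ≤ 3 ∧ 0 < T ∧ T ≤ 10) →
      (100 ≤ Λ ∧ Λ ≤ B * (1 - Real.exp (-σI)) ∧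
        11 * Real.sqrt B * Real.exp (-(κ * Λ / 3)) ≤ ω) →
      (ContinuousOn bp (Icc 0 T) ∧ ContinuousOn wp (Icc 0 T) ∧ ContinuousOn b (Icc 0 T) ∧
        ContinuousOn m0 (Icc 0 T) ∧ ContinuousOn m1 (Icc 0 T) ∧ ContinuousOn wl (Icc 0 T) ∧
        ContinuousOn e0 (Icc 0 T) ∧ ContinuousOn e1 (Icc 0 T)) →
      ((∀ σ ∈ Ioo 0 T, HasDerivAt bp
          (κ * (-(bp σ) - (wp σ) ^ 2 + (wl σ) ^ 2 - εb * bp σ * wp σ) + e0 σ) σ) ∧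
        (∀ σ ∈ Ioo 0 T, HasDerivAt wp
          (κ * (wp σ * (bp σ - b σ / q - 1) + εb * (bp σ) ^ 2) + e1 σ) σ)) →
      ((∀ σ ∈ Icc 0 T, |e0 σ| ≤ η * κ * m0 σ) ∧ (∀ σ ∈ Icc 0 T, |e1 σ| ≤ η * κ * m1 σ) ∧
        (∀ σ ∈ Icc 0 T, 0 ≤ m0 σ ∧ m0 σ ≤ m0 0 * Real.exp (-(θ * κ * σ)) +
          κ * ∫ u in (0 : ℝ)..σ, Real.exp (-(θ * κ * (σ - u))) *
            |-(wp u) ^ 2 + (wl u) ^ 2 - εb * bp u * wp u|) ∧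
        (∀ σ ∈ Icc 0 T, 0 ≤ m1 σ ∧ m1 σ ≤ m1 0 * Real.exp (-(θ * κ * σ)) +
          κ * ∫ u in (0 : ℝ)..σ, Real.exp (-(θ * κ * (σ - u))) *
            |wp u * (bp u - b u / q) + εb * (bp u) ^ 2|)) →
      ((∀ σ ∈ Icc 0 T, |wl σ| ≤ ω) ∧
        (∀ σ ∈ Icc 0 (min T σI), B * Real.exp (-σ) - 3 ≤ b σ) ∧
        (∀ σ ∈ Icc 0 T, -(1 / 2) ≤ b σ ∧ b σ ≤ B + 3)) →
      (q ^ 4 / 2 - 3 / 20 ≤ bp 0 ∧ bp 0 ≤ q ^ 4 / 2 + 1 / 10 ∧ 0 ≤ wp 0 ∧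
        q ^ 3 * B - 1 ≤ (wp 0) ^ 2 ∧ (wp 0) ^ 2 ≤ q ^ 3 * B + 1 ∧ m0 0 ≤ μ ∧ m1 0 ≤ μ) →
      (s ∈ Icc 0 T) →
      (∀ σ ∈ Icc 0 s, -(1 / 2) ≤ bp σ ∧ bp σ ≤ 9 / 10 ∧ (σ ≤ σI ∨ bp σ ≤ 2 / 5) ∧
        m1 σ ≤ μ + 3 * Real.sqrt B ∧ κ * ∫ u in (0 : ℝ)..σ, (wp u) ^ 2 ≤ 1) →
      ∀ t ∈ Icc 0 s, κ * ∫ u in (0 : ℝ)..t, wp u ^ 2 ≤ 16 / 25 :=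
  fun _ _ _ _ _ _ _ _ _ _ _ _ _ _ _ _ _ _ _ _ hκq hsm hBT hΛ hcont hode herr henv hini hs hT _ ht =>
    prevPair_Q_sharp hκq hsm hBT hΛ hcont hode herr henv hini hs hT ht

end Summit.NavierStokesRegularity.NavierStokesRegularity.Theorems.PerpetualPumpAveragedTypeIBlowup

end
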